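import Summits.CriticalPhenomena.PercolationContinuityZ3.Theorems.Transplant.HexShadowVRouteData
import HarnessLib

/-!
# Self-avoiding paths as vertex lists in an arbitrary simple graph (toolkit for `VRouteData` instances)

builds on p205010 (kernel theorem, internal audit signed; external expert review pending) — NOT used in this file.  Lane `prim-bschramm`, seat
`prim-bschramm-p2` (gen 34; class C1b; memo `HOME/bschramm/P2-LATTICES.md` §127); helper file (`--supports stmt-CriticalPhenomena-4575 --as helper`).
«TriFilmPaths» §2 (`TriFilm.FPath`) made generic in the graph: **`GPath G l s t`** — `l` is a self-avoiding path of `G` from `s` to `t` (non-empty vertex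
list, consecutive vertices adjacent, duplicate-free); `single`, `pair`, `reverse`, gluing at a common end vertex (`trans`), prepending an edge (`cons`), the
decomposition `l = s :: (l.tail.dropLast ++ [t])`, transport along a graph isomorphism (`map`); and **`VRouteData.ofPaths`**: the routing data of
«HexShadowVRouteData» from a path `E₁ ⇝ E₂` through the edge `c → y` (interior in `W_R`) and a path `b ⇝ w'` inside `W`, off it, with `c ∼ b`.
The `(111)`-film instance of `ShapedLinkage` assembles its routings with this kit. [cite: DuminilCopinSidoraviciusTassion2016, §2.3 (proof of Fact 2: the paths γ_u, γ_v, γ_w)]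
-/

noncomputable section

namespace Summit.CriticalPhenomena.PercolationContinuityZ3.Theorems.Transplant

open SimpleGraph
open scoped Classical

/-- **`l` is a self-avoiding path of `G` from `s` to `t`** (non-empty, consecutive vertices adjacent, duplicate-free). [folklore] -/
structure GPath {V : Type} (G : SimpleGraph V) (l : List V) (s t : V) : Prop where
  /-- non-empty -/
  ne_nil : l ≠ []
  /-- consecutive vertices adjacent -/
  chain : l.IsChain (fun a b => G.Adj a b)
  /-- self-avoiding -/
  nodup : l.Nodup
  /-- starts at `s` -/
  head : l.head? = some s
  /-- ends at `t` -/
  last : l.getLast? = some t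

namespace GPath

variable {V : Type} {G : SimpleGraph V} {l l₁ l₂ : List V} {s t m : V}

/-- The trivial path. [folklore] -/
theorem single (G : SimpleGraph V) (v : V) : GPath G [v] v v := ⟨by simp, List.IsChain.singleton _, List.nodup_singleton _, rfl, rfl⟩

/-- A single edge. [folklore] -/
theorem pair {u v : V} (h : G.Adj u v) : GPath G [u, v] u v :=
  ⟨by simp, List.isChain_cons_cons.2 ⟨h, List.IsChain.singleton _⟩, by simp [h.ne], rfl, rfl⟩

/-- The start vertex lies on the path. [folklore] -/
theorem head_mem (h : GPath G l s t) : s ∈ l := List.mem_of_mem_head? h.head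

/-- The end vertex lies on the path. [folklore] -/
theorem last_mem (h : GPath G l s t) : t ∈ l := List.mem_of_getLast? h.last

/-- The underlying list starts with `s`. [folklore] -/
theorem eq_cons (h : GPath G l s t) : l = s :: l.tail := by
  obtain ⟨x, xs, rfl⟩ := List.exists_cons_of_ne_nil h.ne_nil
  have hx : x = s := by simpa using h.head
  subst hx; rfl

/-- The last element of the underlying list is `t`. [folklore] -/
theorem getLast_eq (h : GPath G l s t) : l.getLast h.ne_nil = t := by
  have := h.last
  rw [List.getLast?_eq_some_getLast h.ne_nil, Option.some.injEq] at this
  exact this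

/-- Reversal. [folklore] -/
theorem reverse (h : GPath G l s t) : GPath G l.reverse t s where
  ne_nil := by simpa using h.ne_nil
  chain := List.isChain_reverse.2 (h.chain.imp fun _ _ hab => hab.symm)
  nodup := List.nodup_reverse.2 h.nodup
  head := by rw [List.head?_reverse]; exact h.last
  last := by rw [List.getLast?_reverse]; exact h.head

/-- **Gluing two paths at a common end vertex** (the second path's other vertices off the first). [folklore] -/
theorem trans (h₁ : GPath G l₁ s m) (h₂ : GPath G l₂ m t) (hdisj : ∀ v ∈ l₂, v ∈ l₁ → v = m) : GPath G (l₁ ++ l₂.tail) s t := by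
  obtain ⟨x, xs, rfl⟩ := List.exists_cons_of_ne_nil h₂.ne_nil
  have hx : x = m := by simpa using h₂.head
  subst hx
  refine ⟨by simp [h₁.ne_nil], ?_, ?_, ?_, ?_⟩
  · rw [List.isChain_append]
    refine ⟨h₁.chain, ?_, ?_⟩
    · have := h₂.chain
      rw [List.isChain_cons] at this
      exact this.2
    · intro a ha b hb
      rw [h₁.last, Option.mem_def, Option.some.injEq] at ha
      subst ha
      have := h₂.chain
      rw [List.isChain_cons] at this
      exact this.1 b hb
  · rw [List.nodup_append]
    refine ⟨h₁.nodup, (List.nodup_cons.1 h₂.nodup).2, fun a ha b hb hab => ?_⟩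
    subst hab
    have := hdisj a (List.mem_cons_of_mem _ hb) ha
    subst this
    exact (List.nodup_cons.1 h₂.nodup).1 hb
  · rw [List.head?_append, h₁.head]; rfl
  · cases xs with
    | nil =>
      have := h₂.last
      simp only [List.getLast?_singleton, Option.some.injEq] at this
      subst this
      simpa using h₁.last
    | cons y ys =>
      have := h₂.last
      rw [List.tail_cons, List.getLast?_append, List.getLast?_cons_cons] at *
      rw [this]; rfl

/-- **Prepending an edge**: if `u ∼ s` and `u` is off the path. [folklore] -/
theorem cons {u : V} (h : GPath G l s t) (hadj : G.Adj u s) (hu : u ∉ l) : GPath G (u :: l) u t := by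
  have := (pair hadj).trans h (fun v hv hvl => by
    rcases List.mem_cons.1 hvl with rfl | hvl
    · exact absurd hv hu
    · simpa using hvl)
  rw [h.eq_cons]
  simpa [h.eq_cons.symm] using this

/-- A path between distinct vertices splits off both ends: `l = s :: (l.tail.dropLast ++ [t])`. [folklore] -/
theorem eq_cons_dropLast_concat (h : GPath G l s t) (hst : s ≠ t) : l = s :: (l.tail.dropLast ++ [t]) := by
  obtain ⟨x, xs, rfl⟩ := List.exists_cons_of_ne_nil h.ne_nil
  have hx : x = s := by simpa using h.head
  subst hx
  cases xs with
  | nil =>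
    have := h.last
    simp only [List.getLast?_singleton, Option.some.injEq] at this
    exact absurd this hst
  | cons y ys =>
    have hl := h.last
    rw [List.getLast?_cons_cons, List.getLast?_eq_some_getLast (List.cons_ne_nil _ _), Option.some.injEq] at hl
    simp only [List.tail_cons, List.cons.injEq, true_and]
    rw [← hl]
    exact (List.dropLast_append_getLast (List.cons_ne_nil y ys)).symm

/-- All vertices of a path other than its start lie in its tail. [folklore] -/
theorem mem_tail_of_ne (h : GPath G l s t) {v : V} (hv : v ∈ l) (hne : v ≠ s) : v ∈ l.tail := by
  rw [h.eq_cons] at hv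
  rcases List.mem_cons.1 hv with rfl | hv
  · exact absurd rfl hne
  · exact hv

/-- The tail of a path misses its start. [folklore] -/
theorem not_mem_tail (h : GPath G l s t) : s ∉ l.tail := by
  have hnd := h.nodup
  rw [h.eq_cons] at hnd
  exact (List.nodup_cons.1 hnd).1

/-- **Transport along a graph isomorphism.** [folklore] -/
theorem map {V' : Type} {G' : SimpleGraph V'} (α : G ≃g G') (h : GPath G l s t) : GPath G' (l.map α) (α s) (α t) where
  ne_nil := by simpa using h.ne_nil
  chain := by rw [List.isChain_map]; exact h.chain.imp fun a b hab => α.map_adj_iff.2 hab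
  nodup := h.nodup.map α.injective
  head := by rw [List.head?_map, h.head]; rfl
  last := by rw [List.getLast?_map, h.last]; rfl

end GPath

/-! ## The routing data from two paths -/

namespace VRouteData

variable {V : Type} {G : SimpleGraph V}

/-- **`VRouteData` from two paths**: a self-avoiding path `SP : E₁ ⇝ E₂` (`E₁ ≠ E₂`) with interior in `W_R` in which `y` follows `c`, and a
self-avoiding path `Br : b ⇝ w'` inside `W`, off `SP`, with `c ∼ b`. [cite: DuminilCopinSidoraviciusTassion2016, §2.3, proof of Fact 2 (γ_u, γ_v, γ_w)] -/
def ofPaths {WR W : Set V} {E₁ E₂ w' c y b : V} {SP Br : List V} (hSP : GPath G SP E₁ E₂) (hne : E₁ ≠ E₂)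
    (hint : ∀ x ∈ SP.tail.dropLast, x ∈ WR) (hcy : ∃ l₁ l₂ : List V, SP = l₁ ++ c :: y :: l₂) (hBr : GPath G Br b w')
    (hBrW : ∀ x ∈ Br, x ∈ W) (hcb : G.Adj c b) (hoff : ∀ x ∈ Br, x ∉ SP) : VRouteData G WR W E₁ E₂ w' where
  P := SP.tail.dropLast
  c := c
  y := y
  Br := Br
  hP := hint
  hchain := by rw [← hSP.eq_cons_dropLast_concat hne]; exact hSP.chain
  hnodup := by rw [← hSP.eq_cons_dropLast_concat hne]; exact hSP.nodup
  hy := by rw [← hSP.eq_cons_dropLast_concat hne]; exact hcy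
  hBr := hBr.ne_nil
  hBrW := hBrW
  hBrchain := by
    rw [List.isChain_cons]
    refine ⟨fun x hx => ?_, hBr.chain⟩
    rw [hBr.head, Option.mem_def, Option.some.injEq] at hx
    subst hx; exact hcb
  hBrnodup := by
    rw [List.nodup_cons]
    refine ⟨fun hc => hoff _ hc ?_, hBr.nodup⟩
    obtain ⟨l₁, l₂, h⟩ := hcy
    rw [h]; simp
  hBrSP := by rw [← hSP.eq_cons_dropLast_concat hne]; exact hoff
  hBrlast := hBr.getLast_eq

/-- `ofPaths` has successor `y`. [folklore] -/
@[simp] theorem ofPaths_y {WR W : Set V} {E₁ E₂ w' c y b : V} {SP Br : List V} (hSP : GPath G SP E₁ E₂) (hne : E₁ ≠ E₂)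
    (hint : ∀ x ∈ SP.tail.dropLast, x ∈ WR) (hcy : ∃ l₁ l₂ : List V, SP = l₁ ++ c :: y :: l₂) (hBr : GPath G Br b w')
    (hBrW : ∀ x ∈ Br, x ∈ W) (hcb : G.Adj c b) (hoff : ∀ x ∈ Br, x ∉ SP) : (ofPaths hSP hne hint hcy hBr hBrW hcb hoff).y = y := rfl

/-- `ofPaths` has first branch vertex `b`. [folklore] -/
@[simp] theorem ofPaths_b {WR W : Set V} {E₁ E₂ w' c y b : V} {SP Br : List V} (hSP : GPath G SP E₁ E₂) (hne : E₁ ≠ E₂)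
    (hint : ∀ x ∈ SP.tail.dropLast, x ∈ WR) (hcy : ∃ l₁ l₂ : List V, SP = l₁ ++ c :: y :: l₂) (hBr : GPath G Br b w')
    (hBrW : ∀ x ∈ Br, x ∈ W) (hcb : G.Adj c b) (hoff : ∀ x ∈ Br, x ∉ SP) : (ofPaths hSP hne hint hcy hBr hBrW hcb hoff).b = b := by
  show Br.head hBr.ne_nil = b
  rw [List.head_eq_iff_head?_eq_some]
  exact hBr.head

end VRouteData

end Summit.CriticalPhenomena.PercolationContinuityZ3.Theorems.Transplant

end
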